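import Summits.ResolutionOfSingularities.ResolutionOfSingularities.Theorems.PurelyInseparableDim4ResConePowerChain
import Summits.ResolutionOfSingularities.ResolutionOfSingularities.Theorems.PurelyInseparableDim4ResConePowerConeAlgClosed
import HarnessLib
import HarnessLib.Audit.Tags

/-!
# Purely inseparable four-folds — the POWER-CONE PACKAGE along a constant-`(d, e_G = 3)` stretch over an
# ALGEBRAICALLY CLOSED field: `g_k = ℓ_k^d` EXACTLY (no scalar), one frame for the whole stretch

[OURS · counted 0 · cell `res-dim4-pi` · K2(p) lane (holder res-dim4-p-12 g3, slice B) · seat res-dim4-p-2 g3 (brick «e = 3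
chain packaging», desk WORD #80 (b)) · K lane crit-4 g2 (K-A4).]  Nothing here proves K2(p) =
`RidgeBudget.NoAboveFloorTrap p p`, `NoIsolatedTrap p p` or resolution of singularities in dimension ≥ 4 /
characteristic `p`.

Sequel of `…ResConePowerChain` (p674751: `chain_powerCone_package`, `g_k = a_k · ℓ_k^d`) using res-dim4-p-3 g3's
`…ResConePowerConeAlgClosed.resForm_eq_pow_of_finrank_eq_three` (p675719: over `K = K̄` the scalar is absorbed,
`g = ℓ^d`).  Since the located residue of record is stated over algebraically closed fields
(`K2BaseChange.noAboveFloorTrap_iff_midTameSlices_algClosed`, p675531), slice-B hands may use the scalar-free frame: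

* `chain_resForm_eq_pow` — at every stage `k ≥ k₀`: `∃ ℓ ≠ 0`, `resVertex (c k) = ker ℓ`, `resForm (c k) = ℓ^d`;
* **`chain_powerCone_package_algClosed`** — ONE choice `ℓ : ℕ → (Fin 4 → K)`, `λ : ℕ → K` with, for every `k ≥ k₀`:
  `ℓ k ≠ 0`, `resVertex (c k) = ker (ℓ k)`, `resForm (c k) = (Σ C (ℓ k i) Xᵢ)^d`, `ℓ k (j k) + ℓ k ⬝ᵥ b k = 0`,
  `λ k ≠ 0`, `ℓ (k+1) i = λ k * ℓ k i` for `i ≠ j k`, and some `i ≠ j k` carries `ℓ k`.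

[cite: CossartJannsenSaito2020, Thm. 3.10(4), Thm. 3.14]
bears_on: LADDER-RESOLUTION:D157-DOOR2 (res-dim4-pi · K2(p) = `RidgeBudget.NoAboveFloorTrap p p`, slice B).
Supports stmt-ResolutionOfSingularities-16155 (helper).
-/

set_option linter.dupNamespace false -- mandated namespace of this single-conjunct summit

noncomputable section

namespace Summit.ResolutionOfSingularities.ResolutionOfSingularities.Theorems.PIDim4

namespace ResCone

open MvPolynomial Finset
open Literature.AlgebraicGeometry.Resolution
open Literature.AlgebraicGeometry.Resolution.CentreBlowup
open Literature.AlgebraicGeometry.Resolution.Hauser2010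
open Literature.AlgebraicGeometry.Resolution.HauserPerlega2019
open PointBlowup (polarMap additiveSubspace direction)

variable {K : Type} [Field K]

section PowerChainAlgClosed

variable (p : ℕ) [Fact p.Prime] [CharP K p] [DecidableEq K] [IsAlgClosed K]

/-- **THE POWER CONE along the chain, scalar-free over `K = K̄`** (slice B, `d < p`): at every stage `k ≥ k₀` the
residual cone is EXACTLY `ℓ^d` for a non-zero linear form `ℓ` whose kernel is `resVertex (c k)`.
[OURS] [cite: CossartJannsenSaito2020, Thm. 3.14] -/
theorem chain_resForm_eq_pow {c : ℕ → State K}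
    (hc : ∀ k, IsIsolated p (c k).F ∧ Step0 p (c k) (c (k + 1))) (hfloor : ∀ k, ordZero (c k).F ≠ p)
    {k₀ d : ℕ} (hdp : d < p) (hshade : ∀ k, k₀ ≤ k → (c k).shade = (d : ℕ∞))
    (he3 : ∀ k, k₀ ≤ k → Module.finrank K (resVertex (c k)) = 3) {k : ℕ} (hk : k₀ ≤ k) :
    ∃ ℓ : Fin 4 → K, ℓ ≠ 0 ∧ (∀ w, w ∈ resVertex (c k) ↔ dotProduct ℓ w = 0) ∧
      resForm (c k) = (∑ i, C (ℓ i) * X i) ^ d := by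
  obtain ⟨o, ho, -, -, hod⟩ := chain_shade_nat p hc hfloor hshade hk
  obtain ⟨ℓ, hℓ, hV, hform⟩ := resForm_eq_pow_of_finrank_eq_three p ho (by rw [hod]; exact hdp) (he3 k hk)
  refine ⟨ℓ, hℓ, fun w => ?_, by rw [hform, hod]⟩
  rw [hV w]
  rfl

/-- **THE SCALAR-FREE POWER-CONE PACKAGE along a constant-`(d, e_G = 3)` stretch over `K = K̄`**: ONE choice of
vertex forms `ℓ k` and units `λ k` with, for every `k ≥ k₀`: `ℓ k ≠ 0`, `resVertex (c k) = ker (ℓ k)`,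
`resForm (c k) = (Σ C (ℓ k i) Xᵢ)^d`, `ℓ k (j k) + ℓ k ⬝ᵥ b k = 0`, `λ k ≠ 0`, `ℓ (k+1) i = λ k * ℓ k i` for all
`i ≠ j k`, and some letter `i ≠ j k` carries `ℓ k`. [OURS] [cite: CossartJannsenSaito2020, Thm. 3.10(4), Thm. 3.14] -/
theorem chain_powerCone_package_algClosed {c : ℕ → State K} {j : ℕ → Fin 4} {b : ℕ → Fin 4 → K}
    (hc : ∀ k, IsIsolated p (c k).F ∧ Step0 p (c k) (c (k + 1))) (hw : FreeTail.IsWitnessedChain p c j b)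
    (hr0 : ∀ e ∈ (c 0).F.support, (c 0).r ≤ e) (hfloor : ∀ k, ordZero (c k).F ≠ p) {k₀ d : ℕ} (hdp : d < p)
    (hshade : ∀ k, k₀ ≤ k → (c k).shade = (d : ℕ∞))
    (he3 : ∀ k, k₀ ≤ k → Module.finrank K (resVertex (c k)) = 3) :
    ∃ (ℓ : ℕ → Fin 4 → K) (lam : ℕ → K), ∀ k, k₀ ≤ k →
      ℓ k ≠ 0 ∧ (∀ w, w ∈ resVertex (c k) ↔ dotProduct (ℓ k) w = 0) ∧
      resForm (c k) = (∑ i, C (ℓ k i) * X i) ^ d ∧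
      ℓ k (j k) + dotProduct (ℓ k) (b k) = 0 ∧
      lam k ≠ 0 ∧ (∀ i, i ≠ j k → ℓ (k + 1) i = lam k * ℓ k i) ∧
      ∃ i, i ≠ j k ∧ ℓ k i ≠ 0 := by
  have hex : ∀ k, ∃ ℓ : Fin 4 → K, k₀ ≤ k →
      ℓ ≠ 0 ∧ (∀ w, w ∈ resVertex (c k) ↔ dotProduct ℓ w = 0) ∧
        resForm (c k) = (∑ i, C (ℓ i) * X i) ^ d := by
    intro k
    by_cases hk : k₀ ≤ k
    · obtain ⟨ℓ, h⟩ := chain_resForm_eq_pow p hc hfloor hdp hshade he3 hk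
      exact ⟨ℓ, fun _ => h⟩
    · exact ⟨0, fun h => absurd h hk⟩
  choose ℓ hℓ using hex
  have hlam : ∀ k, ∃ lam : K, k₀ ≤ k → lam ≠ 0 ∧ ∀ i, i ≠ j k → ℓ (k + 1) i = lam * ℓ k i := by
    intro k
    by_cases hk : k₀ ≤ k
    · obtain ⟨hℓ0, hV, -⟩ := hℓ k hk
      obtain ⟨-, hV', -⟩ := hℓ (k + 1) (by omega)
      obtain ⟨⟨lam, hlam0, hlam⟩, -, -⟩ :=
        chain_linearForm_proportional p hc hw hr0 hfloor hshade hk hV hV' hℓ0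
      exact ⟨lam, fun _ => ⟨hlam0, hlam⟩⟩
    · exact ⟨0, fun h => absurd h hk⟩
  choose lam hlam' using hlam
  refine ⟨ℓ, lam, fun k hk => ?_⟩
  obtain ⟨hℓ0, hV, hform⟩ := hℓ k hk
  obtain ⟨hlam0, hlamk⟩ := hlam' k hk
  obtain ⟨-, hj⟩ := chain_linearForm_direction p hc hw hr0 hfloor hshade hk hV
  obtain ⟨-, hV', -⟩ := hℓ (k + 1) (by omega)
  obtain ⟨-, hoff, -⟩ := chain_linearForm_proportional p hc hw hr0 hfloor hshade hk hV hV' hℓ0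
  exact ⟨hℓ0, hV, hform, hj, hlam0, hlamk, hoff⟩

end PowerChainAlgClosed

end ResCone

end Summit.ResolutionOfSingularities.ResolutionOfSingularities.Theorems.PIDim4

end
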